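import Summits.QuantumFields.YangMills.Theorems.BalabanUVNodesN08AxialLaunderingWeighted

/-!
# BalabanUVNodes ∕ N08 — WEIGHTED LAUNDERING ALONG THE AXIAL REFERENCE, FIRST-BOND TWIN: a density that does not read the FIRST bond of any straight segment is
# pushed by `AveragingRT.axialAvg` to an exact multiple of product Haar (LEFT translations of the coarse field; Weil's uniqueness in the left-invariant form)

Track A, DAG node N08 ([Balaban1985UV3] Thm 1 p. 257 ∕ Thm 2 p. 272; averaging [Balaban1987RG1] (0.4) p. 253, unguarded branch = the straight transporter of
[Balaban1984PropagatorsI] (1.7) p. 18).  Cell `pub-ymgap`, seat `pub-ymgap-dag-n08-d` g47 (R529-ym summon; LOCATE ∕ DESIGN memo (M1) = (β3′)); `--supports stmt-QuantumFields-19936`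
(helper).  Twin of ✓p754299 `…N08AxialLaunderingWeighted.map_withDensity_axialAvg_eq_smul` (LAST bond ∕ right translations), answering referee ref-G READ597's prose note: a
bump may read the LAST bond of a segment provided it does not read its FIRST bond — the free end is a choice per file (the MIXED choice per segment is a later edition).

CONTENTS ([folklore] lattice arithmetic + measure theory over the tree's objects; nothing of the paper asserted; 0 `def`, 0 `sorry`):
* §1 `line_ne_first` (the first bond `line c 0` of a segment is no later bond of any segment), `first_injective`, ★ `axialAvg_mul_first` (left-multiplying the FIRST bond variable of every
  segment by `g(c)` left-multiplies the straight transporter by `g`) — twins of lit `AveragingRT.line_ne_last ∕ last_injective ∕ axialAvg_mul_last`.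
* §2 `measure_eq_mass_smul_of_left_invariant` — Weil: a finite LEFT-invariant measure is `κ(univ)•π` for any RIGHT-invariant probability `π` (twin of lit
  `AveragingRT.measure_eq_mass_smul_of_invariant`).
* §3 ★★★ `map_withDensity_axialAvg_eq_smul_of_first` — `((dU_j).withDensity f).map axialAvg = (∫⁻ f) • dU_{j+1}` for `f` invariant under LEFT-multiplication of the first bonds.
HONEST: count-neutral helper; hTop ∕ (a)′∀ ∕ hJ NOT proved; N08 NOT discharged; R3 ≠ d = 4 ∕ mass gap ∕ Clay.
-/

noncomputable section

open MeasureTheory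
open scoped ENNReal

namespace Summit.QuantumFields.YangMills.Theorems.BalabanUVNodesN08AxialLaunderingFirstBond

open Literature.MathematicalPhysics.QuantumFieldTheory.Balaban1983to89
open Literature.MathematicalPhysics.QuantumFieldTheory.Balaban1983to89.AveragingRT
open Summit.QuantumFields.YangMills.Theorems.BalabanUVNodesN08AxialLaunderingWeighted (map_withDensity_eq_of_comp_eq)

/-! ## §1 The first bonds of the straight segments -/
section Lines

variable {P : Params} {j : ℕ}

/-- **The FIRST bond `line c′ 0` of a segment is not any LATER bond `line c t`, `0 < t < L`, of any segment** (centred convention: the first bond starts at a block centre, all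
transverse offsets `(L−1)∕2`; a later bond's longitudinal offset differs). [folklore] -/
theorem line_ne_first (hj : j + 1 ≤ P.m + P.K) (c c' : PBond P (j + 1)) {t : ℕ} (ht0 : 0 < t) (ht : t < P.L) :
    line c t ≠ line c' 0 := by
  intro h
  have hL := P.hL.2
  obtain ⟨k, hk⟩ := P.hL.1
  simp only [line, PBond.mk.injEq] at h
  obtain ⟨hs, hdir⟩ := h
  have hfirst := lineSite_eq_lo hj c' (t := 0) (Nat.zero_le _)
  by_cases hlo : t ≤ (P.L - 1) / 2
  · rw [lineSite_eq_lo hj c hlo, hfirst] at hs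
    have := congrFun (blockSite_inj hj hs).2 c.dir
    simp only [offLo, hdir, if_true, Fin.mk.injEq] at this
    omega
  · rw [lineSite_eq_hi hj c (lt_of_not_ge hlo) ht.le, hfirst] at hs
    have := congrFun (blockSite_inj hj hs).2 c.dir
    simp only [offLo, offHi, hdir, if_true, Fin.mk.injEq] at this
    omega

/-- **The first bonds of distinct segments are distinct.** [folklore] -/
theorem first_injective (hj : j + 1 ≤ P.m + P.K) :
    Function.Injective (fun c : PBond P (j + 1) => line c 0) := by
  intro c c' h
  simp only [line, PBond.mk.injEq] at h
  obtain ⟨hs, hdir⟩ := h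
  rw [lineSite_eq_lo hj c (t := 0) (Nat.zero_le _), lineSite_eq_lo hj c' (t := 0) (Nat.zero_le _)] at hs
  have hsrc := (blockSite_inj hj hs).1
  cases c; cases c'; simp_all

variable {G : Type*} [GaugeGroup G]

/-- ★ **Left-multiplying the FIRST bond variable of every segment by `g(c)` left-multiplies the straight transporter by `g`** (standing range; the first bond is the
leftmost factor of `AveragingRT.pathProd`). [cite: Balaban1984PropagatorsI, (1.7) p.18] -/
theorem axialAvg_mul_first (hj : j + 1 ≤ P.m + P.K) (U : GaugeField P j G) (g : GaugeField P (j + 1) G) :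
    axialAvg (fun b => Function.extend (fun c : PBond P (j + 1) => line c 0) g (fun _ => 1) b * U b)
      = fun c => g c * axialAvg U c := by
  funext c
  set k : PBond P j → G := Function.extend (fun c : PBond P (j + 1) => line c 0) g (fun _ => 1) with hk
  have hk_first : k (line c 0) = g c := (first_injective hj).extend_apply g (fun _ => (1 : G)) c
  have hk_late : ∀ t, 0 < t → t < P.L → k (line c t) = 1 := by
    intro t ht0 ht
    rw [hk, Function.extend_apply']
    rintro ⟨c', hc'⟩
    exact line_ne_first hj c c' ht0 ht hc'.symm
  have h1 : ∀ n, 1 ≤ n → n ≤ P.L → pathProd (fun b => k b * U b) c n = g c * pathProd U c n := by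
    intro n hn1 hn
    induction n with
    | zero => exact absurd hn1 (by omega)
    | succ n ih =>
      by_cases hn0 : n = 0
      · subst hn0
        simp only [pathProd, one_mul, hk_first]
      · rw [pathProd, pathProd, ih (by omega) (by omega), hk_late n (by omega) (by omega), one_mul, mul_assoc]
  have hL : 1 ≤ P.L := by have := P.hL.2; omega
  exact h1 P.L hL le_rfl

end Lines

/-! ## §2 Weil's uniqueness, left-invariant form -/
section Weil

variable {Γ : Type*} [Group Γ] [MeasurableSpace Γ] [MeasurableMul₂ Γ]

/-- **A finite LEFT-invariant measure is `κ(univ) • π` for any RIGHT-invariant probability `π`** (compute `∫∫ 1_A(xy) dπ(x) dκ(y)` in both orders). [folklore] -/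
theorem measure_eq_mass_smul_of_left_invariant (π κ : Measure Γ) [IsProbabilityMeasure π] [IsFiniteMeasure κ]
    (hπ : ∀ g : Γ, π.map (fun x => x * g) = π) (hκ : ∀ g : Γ, κ.map (fun y => g * y) = κ) :
    κ = κ Set.univ • π := by
  ext A hA
  have hF : Measurable (fun p : Γ × Γ => A.indicator (fun _ => (1 : ℝ≥0∞)) (p.1 * p.2)) :=
    (measurable_const.indicator hA).comp measurable_mul
  have hswap := lintegral_lintegral_swap (μ := π) (ν := κ)
    (f := fun x y => A.indicator (fun _ => (1 : ℝ≥0∞)) (x * y)) hF.aemeasurable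
  -- inner integral in `y`: `κ (x⁻¹ A) = κ A` (left invariance of `κ`)
  have h1 : ∀ x : Γ, ∫⁻ y, A.indicator (fun _ => (1 : ℝ≥0∞)) (x * y) ∂κ = κ A := by
    intro x
    have hm : Measurable (fun y : Γ => x * y) := measurable_const_mul x
    calc ∫⁻ y, A.indicator (fun _ => (1 : ℝ≥0∞)) (x * y) ∂κ
        = ∫⁻ y, A.indicator (fun _ => (1 : ℝ≥0∞)) y ∂(κ.map (fun y => x * y)) :=
          (lintegral_map (measurable_const.indicator hA) hm).symm
      _ = κ A := by rw [hκ x, lintegral_indicator_const hA, one_mul]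
  -- inner integral in `x`: `π (A y⁻¹) = π A` (right invariance of `π`)
  have h2 : ∀ y : Γ, ∫⁻ x, A.indicator (fun _ => (1 : ℝ≥0∞)) (x * y) ∂π = π A := by
    intro y
    have hm : Measurable (fun x : Γ => x * y) := measurable_mul_const y
    calc ∫⁻ x, A.indicator (fun _ => (1 : ℝ≥0∞)) (x * y) ∂π
        = ∫⁻ x, A.indicator (fun _ => (1 : ℝ≥0∞)) x ∂(π.map (fun x => x * y)) :=
          (lintegral_map (measurable_const.indicator hA) hm).symm
      _ = π A := by rw [hπ y, lintegral_indicator_const hA, one_mul]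
  simp only [h1, h2, lintegral_const, measure_univ, mul_one] at hswap
  rw [Measure.smul_apply, smul_eq_mul, mul_comm]
  exact hswap

end Weil

/-! ## §3 The weighted push-forward, first-bond form -/
section Axial

variable {P : Params} {j : ℕ} {G : Type*} [GaugeGroup G] [MeasurableSpace G] [HaarData G] [MeasurableMul₂ G]

/-- ★★★ **WEIGHTED LAUNDERING, FIRST-BOND FORM.**  If the measurable density `f ≥ 0` (finite integral) is invariant under LEFT-multiplication of the FIRST bond of every straight
segment by an arbitrary coarse field, then `((dU_j).withDensity f).map axialAvg = (∫⁻ f dU_j) • dU_{j+1}` (standing range): the weighted push-forward is left-invariant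
(`axialAvg_mul_first` + the measure-preserving left-multiplication `AveragingRT.measurePreserving_mulLeft`), `dU_{j+1}` is right-invariant, Weil (§2).
[cite: Balaban1984PropagatorsI, (1.7) p.18 (the straight transporter); Balaban1985Averaging, (10) p.19 (bookkeeping)] -/
theorem map_withDensity_axialAvg_eq_smul_of_first (hj : j + 1 ≤ P.m + P.K) {f : GaugeField P j G → ℝ≥0∞} (hf : Measurable f)
    (hfin : ∫⁻ U, f U ∂(fieldMeasure P j G) ≠ ∞)
    (hfirst : ∀ (g : GaugeField P (j + 1) G) (U : GaugeField P j G),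
      f (fun b => Function.extend (fun c : PBond P (j + 1) => line c 0) g (fun _ => 1) b * U b) = f U) :
    ((fieldMeasure P j G).withDensity f).map (axialAvg : GaugeField P j G → GaugeField P (j + 1) G) =
      (∫⁻ U, f U ∂(fieldMeasure P j G)) • fieldMeasure P (j + 1) G := by
  letI : Group (GaugeField P (j + 1) G) := Pi.group
  letI : MeasurableMul₂ (GaugeField P (j + 1) G) := Pi.measurableMul₂
  have hmeas : Measurable (axialAvg : GaugeField P j G → GaugeField P (j + 1) G) := measurable_axialAvg
  haveI : IsFiniteMeasure ((fieldMeasure P j G).withDensity f) := isFiniteMeasure_withDensity hfin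
  haveI : IsFiniteMeasure (((fieldMeasure P j G).withDensity f).map (axialAvg : GaugeField P j G → GaugeField P (j + 1) G)) :=
    Measure.isFiniteMeasure_map _ _
  have h := measure_eq_mass_smul_of_left_invariant (fieldMeasure P (j + 1) G)
    (((fieldMeasure P j G).withDensity f).map (axialAvg : GaugeField P j G → GaugeField P (j + 1) G)) ?_ ?_
  · rw [h, Measure.map_apply hmeas MeasurableSet.univ, Set.preimage_univ, withDensity_apply _ MeasurableSet.univ,
      Measure.restrict_univ]
  · intro g
    exact (measurePreserving_mulRight (P := P) (j := j + 1) g).map_eq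
  · intro g
    set R : GaugeField P j G → GaugeField P j G := fun U b =>
      Function.extend (fun c : PBond P (j + 1) => line c 0) g (fun _ => 1) b * U b with hR
    have hRmp : MeasurePreserving R (fieldMeasure P j G) (fieldMeasure P j G) := measurePreserving_mulLeft _
    have hRf : ((fieldMeasure P j G).withDensity f).map R = (fieldMeasure P j G).withDensity f :=
      map_withDensity_eq_of_comp_eq hRmp hf (fun U => hfirst g U)
    have hcomp : ((fun x => g * x) ∘ (axialAvg : GaugeField P j G → GaugeField P (j + 1) G)) = axialAvg ∘ R := by
      funext U
      show (fun c => g c * axialAvg U c) = axialAvg (R U)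
      rw [hR, axialAvg_mul_first hj]
    calc (((fieldMeasure P j G).withDensity f).map axialAvg).map (fun x => g * x)
        = ((fieldMeasure P j G).withDensity f).map ((fun x => g * x) ∘ axialAvg) := Measure.map_map (measurable_const_mul g) hmeas
      _ = ((fieldMeasure P j G).withDensity f).map (axialAvg ∘ R) := by rw [hcomp]
      _ = (((fieldMeasure P j G).withDensity f).map R).map axialAvg := (Measure.map_map hmeas hRmp.measurable).symm
      _ = ((fieldMeasure P j G).withDensity f).map axialAvg := by rw [hRf]

end Axial

end Summit.QuantumFields.YangMills.Theorems.BalabanUVNodesN08AxialLaunderingFirstBond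

end
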